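/-
Copyright (c) 2026. All rights reserved.
Released under Apache 2.0 license as described in the file LICENSE.
Authors: abc-iut cell, seat abc-iut-L4-t10 (gen 4; block W2-B4 model column, nodes `AbsTopIII:Cor4.5(iii)`,
`(v)`: the full corollary at the archimedean model modulo the telecore half of (iii) only).
-/
import Literature.AnabelianGeometry.AbsoluteAnabelian.AbsTopIII.FrobeniusPictureMLFShiftCompatibleModel
import Literature.AnabelianGeometry.AbsoluteAnabelian.AbsTopIII.FrobeniusPictureMLFShiftTelecoreCompatible
import Literature.AnabelianGeometry.AbsoluteAnabelian.AbsTopIII.FrobeniusPictureMLFLogGlueCrossClosure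
import Literature.AnabelianGeometry.AbsoluteAnabelian.AbsTopIII.AutHolLogFrobeniusCompatibility
import Literature.AnabelianGeometry.AbsoluteAnabelian.AbsTopIII.AutHolLogFrobeniusModelIotaProofs
import Literature.AnabelianGeometry.AbsoluteAnabelian.AbsTopIII.AutHolLogFrobeniusModelProofs
import Literature.AnabelianGeometry.AbsoluteAnabelian.AbsTopIII.AutHolLogFrobeniusGaloisModel
import Literature.AnabelianGeometry.AbsoluteAnabelian.ArchimedeanHolFieldFunctorGeometricCarriersProofs
import Literature.AnabelianGeometry.AbsoluteAnabelian.ArchimedeanHolFieldFunctorGeometricRC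
import HarnessLib

/-!
# [AbsTopIII] Cor 4.5 (v), third sentence — the nexus self-equivalences are compatible with the cores and
# the observable — DISCHARGED at the archimedean models with NO residual hypothesis; Corollary 4.5 with
# ALL its printed clauses at the archimedean models modulo the TELECORE half of (iii) only

S. Mochizuki, *Topics in Absolute Anabelian Geometry III*, Cor 4.5 (v) p. 109 l. 15–17 (kurims
manuscript, lit key `paper:url-5493eb38cbb7`, read on the page; bib key `MochizukiAbsTopIII2015`):
"Finally, the self-equivalences in these nexus-classes are compatible with the families of homotopies
that constitute the cores and observable of (i), (iii)."  Printed proof (p. 110): "Assertion (v) follows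
by applying the argument applied in the proof of Corollary 3.6, (v)."  Typed by seat abc-iut-L4-t10 as
the FIRST conjunct `Δ.ShiftCompatStmt` of `AbsTopIII.Cor_4_5_v_compat Δ τ` (`AutHolLogFrobeniusCompatibility.lean`;
abc-iut-L4-t5's literal Def 3.5 (v) statement, imported, never restated).  PROOF-ONLY file.

State of the tree before this file.  abc-iut-w6-d023's «Cor36-SHIFT» chain (p433670 / p433920 / p434771 /
p436955 / p437463 / p437640 / p438026) PROVES the third sentence over ABSTRACT data from the named fact
`IotaOverGaloisStmt` alone (`LogFrobeniusData.shiftCompatStmt_of_iotaOverGaloisStmt`: the shifts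
`Φ_m = shiftEquiv m` are compatible in the sense of Def. 3.5 (v) with the master family `glueFamily` of
abc-iut-w5-d053, which realises the cores and `𝔖_log`), unconditionally at the `TF` model
(`TFModel.shiftCompatStmt_model`).  At the archimedean model `𝒳 = 𝒞^hol_TF` the fact is seat
abc-iut-L4-t10's `arch_iotaOverGaloisStmt` (gen 3, p427358); sentence 4 and the cores half of the (iii)
clause are already zero-binder there (p436692, p438427 — whose `TM` twins, via gen 4's
`archTM_iotaOverGaloisStmt`, follow in the sequel once those modules are built; this file imports neither,
the two needed terms being re-derived inline from abc-iut-w6-d025's / -w5-d053's abstract theorems).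

This file (every theorem a short application BY NAME):

* `AbsTopIII.cor_4_5_v_shiftCompat_arch` — **the third sentence of Cor 4.5 (v) at the archimedean model
  `𝒳 = 𝒞^hol_TF` for EVERY interface datum `𝔄`, ZERO binders**; zero-binder corollaries at the
  constant-field data, the Galois categories `B(Π)` (no slimness input) and the geometric carriers
  `EA^hol_RS(Q)` / `RC(Q)` (no id-rigidity / Lemma-4.3 input).
* `AbsTopIII.cor_4_5_v_compat_arch` — **sentences 3 ∧ 4 of (v) (`Cor_4_5_v_compat`) at the archimedean
  model, ZERO binders** (sentence 4: abc-iut-w6-d025's `shiftTelecoreCompatStmt_of_coherent` at the model,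
  the term of `cor_4_5_v_shiftTelecoreCompat_arch`, p436692).
* `AbsTopIII.cor_4_5_v_all_arch` — item (v) with ALL its sentences at the model from `𝕏₀ : EA` and
  `IsIdRigid EA` (the first two sentences — nexus classes, total `□`-rigidity, the `ℤ`-action — are gen 2's
  `cor_4_5_arch`; Prop 4.2 (i)).
* `AbsTopIII.cor_4_5_full_arch_iff_logObsCompatTelecore` — **at the archimedean model, given the five
  typed items (`Cor_4_5`, e.g. from `𝕏₀ : EA` and `IsIdRigid EA`), `Cor_4_5_full` (the five items AND the
  three compatibility sentences) holds IFF the TELECORE half of the (iii) clause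
  (`LogObsCompatTelecoreStmt`, abc-iut-w6-d025's row «LogObsCompatTelecore») does** — the one input still
  open at the archimedean model, by name; with the zero-binder instances over the geometric carriers
  `{ℂ, ℂˣ, 𝔻}` (gen 3's `cor_4_5_geometric_carriers`) and over `B(G_{ℚ_p})` (gen 3's
  `cor_4_5_arch_absoluteGaloisGroup_padic`), and the slim-`Π` Galois-category form.

HONEST SCOPE: model-level ≠ node-level ≠ reconstruction; the models' `𝒩` is `𝒞^hol_TH` restricted to
arithmetic data inside CAFs (scope note of `ArchimedeanLogFrobeniusModel.lean`); the geometric `EA` of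
Cor 2.7 enters only through the interface `AutHolFieldFunctor` and its genuine instances.  Refereed
pre-IUT anabelian geometry; nothing here bears on [IUTchIII] Cor. 3.12 or takes a side; typed ≠ proved.
-/

namespace Literature.AnabelianGeometry.AbsoluteAnabelian

open _root_.CategoryTheory

universe u

namespace AbsTopIII

variable (𝔄 : AutHolFieldFunctor.{u})

/-! ### The third sentence of (v) at the archimedean model `𝒳 = 𝒞^hol_TF`, every `𝔄`, zero binders -/

/-- **[AbsTopIII] Cor 4.5 (v), third sentence, at the archimedean MODEL `𝒳 = 𝒞^hol_TF` for EVERY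
interface datum `𝔄 : AutHolFieldFunctor`, with NO further hypothesis**: the nexus self-equivalences
`Φ_m` of `𝒟` (translation of the first row by `m`) are compatible, in the sense of Def. 3.5 (v), with one
family of homotopies realising the cores of (i) and the observable `𝔖_log` of (iii) (`ShiftCompatStmt`) —
abc-iut-w6-d023's `shiftCompatStmt_of_iotaOverGaloisStmt` fed with gen 3's `arch_iotaOverGaloisStmt`.
[cite: MochizukiAbsTopIII2015, Corollary 4.5 (v) p.109] -/
theorem cor_4_5_v_shiftCompat_arch : (archLogFrobeniusData 𝔄).ShiftCompatStmt :=
  (archLogFrobeniusData 𝔄).shiftCompatStmt_of_iotaOverGaloisStmt (arch_iotaOverGaloisStmt 𝔄)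

/-- Cor 4.5 (v), third sentence, at the archimedean model over EVERY constant-field datum `EA := E`, zero
binders. [cite: MochizukiAbsTopIII2015, Corollary 4.5 (v) p.109] -/
theorem cor_4_5_v_shiftCompat_ofConstField (E : Type 1) [Category.{1} E] :
    (archLogFrobeniusData (AutHolFieldFunctor.ofConstField E)).ShiftCompatStmt :=
  cor_4_5_v_shiftCompat_arch _

/-- **Cor 4.5 (v), third sentence, at the Galois-category instance `EA = B(Π)` for EVERY topological group
`Π`, with NO slimness hypothesis.** [cite: MochizukiAbsTopIII2015, Corollary 4.5 (v) p.109] -/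
theorem cor_4_5_v_shiftCompat_ofGaloisCategory (G : Type) [Group G] [TopologicalSpace G] :
    (archLogFrobeniusData (AutHolFieldFunctor.ofGaloisCategory G)).ShiftCompatStmt :=
  cor_4_5_v_shiftCompat_arch _

/-! ### Sentences 3 ∧ 4 of (v), and item (v) in full, at the archimedean model -/

/-- **[AbsTopIII] Cor 4.5 (v), third AND fourth sentences (`Cor_4_5_v_compat`) at the archimedean MODEL
`𝒳 = 𝒞^hol_TF`, every `𝔄`, ZERO binders** (sentence 4: `id_⋎ = 𝟭` fully faithful and the telecore datum
coherent, `arch_telecore_coherent` — the term of `cor_4_5_v_shiftTelecoreCompat_arch`, p436692).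
[cite: MochizukiAbsTopIII2015, Corollary 4.5 (v) p.109] -/
theorem cor_4_5_v_compat_arch : Cor_4_5_v_compat (archLogFrobeniusData 𝔄) (archTelecoreData 𝔄) :=
  ⟨cor_4_5_v_shiftCompat_arch 𝔄,
    (archLogFrobeniusData 𝔄).shiftTelecoreCompatStmt_of_coherent (archTelecoreData 𝔄)
      (Functor.FullyFaithful.id (HolTFPair 𝔄)) (arch_telecore_coherent 𝔄)⟩

/-- **Cor 4.5 (v) with ALL its sentences at the archimedean model `𝒳 = 𝒞^hol_TF`** from exactly the two
inputs of the first two sentences: an object `𝕏₀` of `EA` and the id-rigidity of `EA` (Prop 4.2 (i)) —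
nexus classes, total `□`-rigidity and the `ℤ`-action (`Cor_4_5_v`, gen 2's `cor_4_5_arch_items`) together with
the two compatibility sentences (zero-binder, above). [cite: MochizukiAbsTopIII2015, Corollary 4.5 (v) p.109] -/
theorem cor_4_5_v_all_arch (X₀ : 𝔄.EA) (hE : IsIdRigid 𝔄.EA) :
    Cor_4_5_v (archLogFrobeniusData 𝔄) ∧ Cor_4_5_v_compat (archLogFrobeniusData 𝔄) (archTelecoreData 𝔄) :=
  ⟨(cor_4_5_arch_items 𝔄 X₀ hE).2.2.2.2, cor_4_5_v_compat_arch 𝔄⟩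

/-! ### Corollary 4.5 in full at the archimedean models: only the telecore half of (iii) remains -/

/-- **Corollary 4.5 with ALL its printed clauses at the archimedean model `𝒳 = 𝒞^hol_TF`, given the five
typed items, holds IFF the telecore half of the (iii) compatibility clause does**: the cores half of (iii)
(abc-iut-w5-d053's `logObsCompatCoresStmt_of_iotaOverGaloisStmt` at gen 3's `arch_iotaOverGaloisStmt` — the term
of `cor_4_5_iii_compatCores_arch`, p438427) and both sentences of (v) (above) are zero-binder theorems at
the model, so `Cor_4_5_full` reduces to `Cor_4_5 ∧ LogObsCompatTelecoreStmt` — the telecore half (one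
family on `𝒟_LH` containing the telecore family and the `𝔖_log` family; abc-iut-w6-d025's row
«LogObsCompatTelecore») being the ONE input still open there.
[cite: MochizukiAbsTopIII2015, Corollary 4.5 pp.107–109] -/
theorem cor_4_5_full_arch_iff_of_cor_4_5
    (h : Cor_4_5 (archLogFrobeniusData 𝔄) (archTelecoreData 𝔄)) :
    Cor_4_5_full (archLogFrobeniusData 𝔄) (archTelecoreData 𝔄) ↔
      (archLogFrobeniusData 𝔄).LogObsCompatTelecoreStmt (archTelecoreData 𝔄) :=
  ⟨fun hf => hf.2.1.2,
    fun ht => ⟨h,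
      ⟨(archLogFrobeniusData 𝔄).logObsCompatCoresStmt_of_iotaOverGaloisStmt (arch_iotaOverGaloisStmt 𝔄), ht⟩,
      cor_4_5_v_compat_arch 𝔄⟩⟩

/-- **`Cor_4_5_full` at the archimedean model from `𝕏₀ : EA`, `IsIdRigid EA` and the telecore half of
(iii) ONLY** (the five items from the first two by gen 2's `cor_4_5_arch`).
[cite: MochizukiAbsTopIII2015, Corollary 4.5 pp.107–109] -/
theorem cor_4_5_full_arch_of_logObsCompatTelecore (X₀ : 𝔄.EA) (hE : IsIdRigid 𝔄.EA)
    (ht : (archLogFrobeniusData 𝔄).LogObsCompatTelecoreStmt (archTelecoreData 𝔄)) :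
    Cor_4_5_full (archLogFrobeniusData 𝔄) (archTelecoreData 𝔄) :=
  (cor_4_5_full_arch_iff_of_cor_4_5 𝔄 (cor_4_5_arch 𝔄 X₀ hE)).mpr ht

/-- At the archimedean model, given `𝕏₀ : EA` and `IsIdRigid EA`, the full corollary is EQUIVALENT to the
telecore half of the (iii) clause. [cite: MochizukiAbsTopIII2015, Corollary 4.5 pp.107–109] -/
theorem cor_4_5_full_arch_iff_logObsCompatTelecore (X₀ : 𝔄.EA) (hE : IsIdRigid 𝔄.EA) :
    Cor_4_5_full (archLogFrobeniusData 𝔄) (archTelecoreData 𝔄) ↔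
      (archLogFrobeniusData 𝔄).LogObsCompatTelecoreStmt (archTelecoreData 𝔄) :=
  cor_4_5_full_arch_iff_of_cor_4_5 𝔄 (cor_4_5_arch 𝔄 X₀ hE)

/-- **At the Galois-category instance `EA = B(Π)` of a SLIM profinite `Π` with an object `𝕏₀`** (print's
route Prop 4.2 (i) ⟸ Lemma 4.3; gen 3's `cor_4_5_arch_ofGaloisCategory`): `Cor_4_5_full` iff the telecore
half of (iii). [cite: MochizukiAbsTopIII2015, Corollary 4.5 pp.107–109] -/
theorem cor_4_5_full_arch_ofGaloisCategory_iff (G : Type) [Group G] [TopologicalSpace G]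
    [IsTopologicalGroup G] [CompactSpace G] [T2Space G] [TotallyDisconnectedSpace G]
    (hG : Literature.AlgebraicGeometry.Frobenioids.IsSlimGroup G)
    (X₀ : Literature.AlgebraicGeometry.Frobenioids.BCat G) :
    Cor_4_5_full (archLogFrobeniusData (AutHolFieldFunctor.ofGaloisCategory G))
        (archTelecoreData (AutHolFieldFunctor.ofGaloisCategory G)) ↔
      (archLogFrobeniusData (AutHolFieldFunctor.ofGaloisCategory G)).LogObsCompatTelecoreStmt
        (archTelecoreData (AutHolFieldFunctor.ofGaloisCategory G)) :=
  cor_4_5_full_arch_iff_of_cor_4_5 _ (cor_4_5_arch_ofGaloisCategory hG X₀)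

/-- **At the unconditional instance `Π := G_{ℚ_p}`** (gen 3's `cor_4_5_arch_absoluteGaloisGroup_padic`: slim by
[pGC], object the one-point `Π`-set): `Cor_4_5_full` iff the telecore half of (iii), ZERO binders.
[cite: MochizukiAbsTopIII2015, Corollary 4.5 pp.107–109] -/
theorem cor_4_5_full_arch_absoluteGaloisGroup_padic_iff (p : ℕ) [Fact p.Prime] :
    Cor_4_5_full (archLogFrobeniusData (AutHolFieldFunctor.ofGaloisCategory (Field.absoluteGaloisGroup ℚ_[p])))
        (archTelecoreData (AutHolFieldFunctor.ofGaloisCategory (Field.absoluteGaloisGroup ℚ_[p]))) ↔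
      (archLogFrobeniusData (AutHolFieldFunctor.ofGaloisCategory (Field.absoluteGaloisGroup ℚ_[p]))).LogObsCompatTelecoreStmt
        (archTelecoreData (AutHolFieldFunctor.ofGaloisCategory (Field.absoluteGaloisGroup ℚ_[p]))) :=
  cor_4_5_full_arch_iff_of_cor_4_5 _ (cor_4_5_arch_absoluteGaloisGroup_padic p)

end AbsTopIII

namespace HolRS

/-- **Cor 4.5 (v), third sentence, at the GEOMETRIC model for EVERY object property `Q` of connected
Riemann surfaces** (`EA = EA^hol_RS(Q)`; in particular print's elliptically admissible hyperbolic
orbicurves), with NO id-rigidity / Lemma-4.3 input. [cite: MochizukiAbsTopIII2015, Corollary 4.5 (v) p.109] -/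
theorem cor_4_5_v_shiftCompat_geometric (Q : ObjectProperty HolRS) :
    (archLogFrobeniusData (geometricAutHolFieldFunctor Q)).ShiftCompatStmt :=
  AbsTopIII.cor_4_5_v_shiftCompat_arch _

/-- Cor 4.5 (v), third sentence, at the RC-holomorphic geometric model, every `Q`, zero binders.
[cite: MochizukiAbsTopIII2015, Corollary 4.5 (v) p.109] -/
theorem cor_4_5_v_shiftCompat_geometricRC (Q : ObjectProperty RC) :
    (archLogFrobeniusData (geometricAutHolFieldFunctorRC Q)).ShiftCompatStmt :=
  AbsTopIII.cor_4_5_v_shiftCompat_arch _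

/-- **Over the geometric carriers `{ℂ, ℂˣ, 𝔻}` — where Cor 4.5 (i)–(v) as typed hold OUTRIGHT (gen 3's
`cor_4_5_geometric_carriers`: id-rigidity of `EA^hol_RS` proved from the rigidity of `Aut(ℂ)`, `Aut(ℂˣ)`,
`Aut(𝔻)`) — `Cor_4_5_full` holds IFF the telecore half of the (iii) clause does, ZERO binders.**
[cite: MochizukiAbsTopIII2015, Corollary 4.5 pp.107–109] -/
theorem cor_4_5_full_geometric_carriers_iff :
    AbsTopIII.Cor_4_5_full
        (archLogFrobeniusData (geometricAutHolFieldFunctor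
          (fun X : HolRS => X = complexPlane ∨ X = puncturedPlane ∨ X = disc)))
        (archTelecoreData (geometricAutHolFieldFunctor
          (fun X : HolRS => X = complexPlane ∨ X = puncturedPlane ∨ X = disc))) ↔
      (archLogFrobeniusData (geometricAutHolFieldFunctor
          (fun X : HolRS => X = complexPlane ∨ X = puncturedPlane ∨ X = disc))).LogObsCompatTelecoreStmt
        (archTelecoreData (geometricAutHolFieldFunctor
          (fun X : HolRS => X = complexPlane ∨ X = puncturedPlane ∨ X = disc))) :=
  AbsTopIII.cor_4_5_full_arch_iff_of_cor_4_5 _ cor_4_5_geometric_carriers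

/-- Over the geometric carrier property `Q` with an object and id-rigid `EA^hol_RS(Q)` (abc-iut-L4-t14's
`cor_4_5_geometric`), `Cor_4_5_full` iff the telecore half of (iii).
[cite: MochizukiAbsTopIII2015, Corollary 4.5 pp.107–109] -/
theorem cor_4_5_full_geometric_iff (Q : ObjectProperty HolRS) (X₀ : (geometricAutHolFieldFunctor Q).EA)
    (hE : IsIdRigid (geometricAutHolFieldFunctor Q).EA) :
    AbsTopIII.Cor_4_5_full (archLogFrobeniusData (geometricAutHolFieldFunctor Q))
        (archTelecoreData (geometricAutHolFieldFunctor Q)) ↔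
      (archLogFrobeniusData (geometricAutHolFieldFunctor Q)).LogObsCompatTelecoreStmt
        (archTelecoreData (geometricAutHolFieldFunctor Q)) :=
  AbsTopIII.cor_4_5_full_arch_iff_of_cor_4_5 _ (cor_4_5_geometric Q X₀ hE)

end HolRS

end Literature.AnabelianGeometry.AbsoluteAnabelian
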